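import Summits.Ventures.Crystal3D.Theorems.StickyWulffConstantGenericWallFloorRayTerraceFar
import HarnessLib

/-!
# The terrace-steered steep family, part 6: `hfar` against THREE-letter words through the terrace (the `Σ27`-type
# cap relations) (crux `GenericWallFloor`, stmt-Ventures-19480, line `WallLedgerG`; item (G-a) of cf-p1 DECISION (xlii))

HONEST FRAMING. Venture `Summits/Ventures/Crystal3D` (cell `crystal3d-full`), helper `--supports` the crux `GenericWallFloor`
(stmt-Ventures-19480) of `route-Ventures-StickyWulffConstant`, REGISTERED line `WallLedgerG`, open stub `stub_twoSlabAdhesion`.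
Rung credit only; F-C1 not moved; NOT the stub; census-free, standard axioms.

Sequel of `…RayTerraceFar` (`image_ne_of_terrace_word`, two letters = the `Σ9` cap).  Here the far lattice is presented over the
walker's frame `A` by a reduced THREE-letter model word `[κ₀, κ₁, κ₂]` whose first-applied letter `κ₂` is the terrace normal
`±(1,1,1)/√3` — the `Σ27`-type relations (`Σ27a`, `Σ27b`) reached through the terrace, the next caps in TILT-COVERAGE order.
* `terrace_letter_two` — the THIRD letter of ray a: the level-1 next normal `(7/9,−5/9,13/9)/√3` (`rayA_level1`) pulled back
  through the two mirrors of levels 0 and 1 has cubic coordinates `(−1,−1,1)/√3`.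
* **`image_ne_of_terrace_word_three`** — if `B·Λ₀ = (wordFrame A [κ₀, κ₁, κ₂])·Λ₀` with `κ₂ = ±(1,1,1)/√3` and the word is NOT
  the family's own level-2 arrival word, i.e. NOT (`κ₁ = ±(1,−1,−1)/√3` AND `κ₀ = ±(−1,−1,1)/√3`), then no frame of any sound
  well-formed stack of the terrace family (`cubicCoords (A.symm z) ∥ (34,32,33)`, bottom `⟨A, slotSite 8, 0⟩`) IS `B·Λ₀`.
  Mechanism as in part 5 (`map_reflection_eq_of_image_eq`: reduced words are rigid ⇒ a stack of exactly three pushes with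
  letters `±κ₂, ±κ₁, ±κ₀`; ray b dies at the first letter `(−1,1,1)/√3 ≠ ±κ₂`; ray a has letters `(1,1,1), (1,−1,−1), (−1,−1,1)`
  (all `/√3`) by `terrace_letter_one/two`).  Linear (no translation): serves every relative translation of the pair.
The excluded word `[±(−1,−1,1), ±(1,−1,−1), ±(1,1,1)]/√3` is the ARRIVAL relation of the family at level 2 (the walker enters the
far grain after three pushes) — a different mechanism (arrival), not a cap.
WHAT THIS IS NOT: not the ledger, no packing statement, not the `hdirs`/capstone instantiation on these caps; F-C1 not moved.
-/

noncomputable section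

namespace Summit.Ventures.Crystal3D.Theorems

open Summit.Ventures.Crystal3D Finset Matrix
open Literature.MathematicalPhysics.StatisticalMechanics (fccStacking)
open scoped InnerProductSpace

/-- **The third letter of ray a**: the level-1 next normal pulled back through the level-1 frame (two mirrors: the terrace and
the level-0 next normal) has cubic coordinates `(−1,−1,1)/√3`. -/
theorem terrace_letter_two (A : EuclideanSpace ℝ (Fin 3) ≃ₗᵢ[ℝ] EuclideanSpace ℝ (Fin 3))
    {n z : EuclideanSpace ℝ (Fin 3)} {t : ℝ} (hn : ‖n‖ = 1)
    (hmenu : ∀ w ∈ fccSlots, ⟪A w, n⟫_ℝ = 0 ∨ ⟪A w, n⟫_ℝ = Real.sqrt (2 / 3) ∨ ⟪A w, n⟫_ℝ = -Real.sqrt (2 / 3))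
    (hpos : ⟪A (slotSite 8), n⟫_ℝ = Real.sqrt (2 / 3))
    (hPa : cubicCoords (A.symm n) = (Real.sqrt 3)⁻¹ • (![(1 : ℝ), 1, 1] : Fin 3 → ℝ))
    (hZ : cubicCoords (A.symm z) = t • (![(34 : ℝ), 32, 33] : Fin 3 → ℝ)) (ht : 0 < t) :
    cubicCoords ((forcedTop z ⟨A, slotSite 8, 0⟩ n 1).frame.symm (nextNormal (forcedTop z ⟨A, slotSite 8, 0⟩ n 1))) =
      (Real.sqrt 3)⁻¹ • (![(-1 : ℝ), -1, 1] : Fin 3 → ℝ) := by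
  obtain ⟨hs2, hs3, hs2p, hs3p, h23⟩ := sqrt_two_three_facts
  obtain ⟨-, hP1⟩ := rayA_level0 A hn hmenu hpos hPa hZ ht
  obtain ⟨-, hP2⟩ := rayA_level1 A hn hmenu hpos hPa hZ ht
  have hn₁ : ‖nextNormal (forcedTop z ⟨A, slotSite 8, 0⟩ n 0)‖ = 1 :=
    (forcedTop_chain_invariant z A (slotSite 8) hn hmenu 1).1
  have hfr1 : (forcedTop z ⟨A, slotSite 8, 0⟩ n 1).frame =
      twinFrame (forcedTop z ⟨A, slotSite 8, 0⟩ n 0).frame (nextNormal (forcedTop z ⟨A, slotSite 8, 0⟩ n 0)) := rfl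
  have hfr0 : (forcedTop z ⟨A, slotSite 8, 0⟩ n 0).frame = twinFrame A n := rfl
  -- `⟪n₂, n₁⟫ = 1/3`
  have hin21 : ⟪nextNormal (forcedTop z ⟨A, slotSite 8, 0⟩ n 1), nextNormal (forcedTop z ⟨A, slotSite 8, 0⟩ n 0)⟫_ℝ = 1 / 3 := by
    rw [inner_eq_cubic_symm A, hP2, hP1, smul_dotProduct, dotProduct_smul, smul_eq_mul, smul_eq_mul]
    norm_num [dotProduct, Fin.sum_univ_three, Matrix.cons_val_zero, Matrix.cons_val_one, Matrix.cons_val_two,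
      Matrix.head_cons, Matrix.tail_cons]
    field_simp; linarith [hs3]
  -- the once-reflected normal `m = R_{n₁} n₂` in cubic coordinates
  have hm : cubicCoords (A.symm ((ℝ ∙ nextNormal (forcedTop z ⟨A, slotSite 8, 0⟩ n 0))ᗮ.reflection
      (nextNormal (forcedTop z ⟨A, slotSite 8, 0⟩ n 1)))) = (Real.sqrt 3)⁻¹ • (![(-1 : ℝ)/3, -1/3, 5/3] : Fin 3 → ℝ) := by
    rw [reflection_unit_apply hn₁, hin21, map_sub, cubicCoords_sub, LinearIsometryEquiv.map_smul, cubicCoords_smul, hP2, hP1,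
      smul_smul]
    ext i
    fin_cases i <;> norm_num [Matrix.cons_val_zero, Matrix.cons_val_one, Matrix.cons_val_two, Matrix.head_cons,
      Matrix.tail_cons] <;> field_simp <;> linarith [hs3]
  -- `⟪m, n⟫ = 1/3`
  have hin_m : ⟪(ℝ ∙ nextNormal (forcedTop z ⟨A, slotSite 8, 0⟩ n 0))ᗮ.reflection
      (nextNormal (forcedTop z ⟨A, slotSite 8, 0⟩ n 1)), n⟫_ℝ = 1 / 3 := by
    rw [inner_eq_cubic_symm A, hm, hPa, smul_dotProduct, dotProduct_smul, smul_eq_mul, smul_eq_mul]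
    norm_num [dotProduct, Fin.sum_univ_three, Matrix.cons_val_zero, Matrix.cons_val_one, Matrix.cons_val_two,
      Matrix.head_cons, Matrix.tail_cons]
    field_simp; linarith [hs3]
  rw [hfr1, twinFrame_symm_apply, hfr0, twinFrame_symm_apply, reflection_unit_apply hn, map_sub, cubicCoords_sub,
    LinearIsometryEquiv.map_smul, cubicCoords_smul, hm, hin_m, hPa, smul_smul]
  ext i
  fin_cases i <;> norm_num [Matrix.cons_val_zero, Matrix.cons_val_one, Matrix.cons_val_two, Matrix.head_cons,
    Matrix.tail_cons] <;> field_simp <;> linarith [hs3]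

/-- **`hfar` for the terrace family against a three-letter word through the terrace.**  See the module docstring. -/
theorem image_ne_of_terrace_word_three (A B : EuclideanSpace ℝ (Fin 3) ≃ₗᵢ[ℝ] EuclideanSpace ℝ (Fin 3))
    {z : EuclideanSpace ℝ (Fin 3)} {t : ℝ}
    (hZ : cubicCoords (A.symm z) = t • (![(34 : ℝ), 32, 33] : Fin 3 → ℝ)) (ht : 0 < t)
    (κ₀ κ₁ κ₂ : EuclideanSpace ℝ (Fin 3))
    (hκl : ∀ μ ∈ [κ₀, κ₁, κ₂], ‖μ‖ = 1 ∧
      ∀ w ∈ fccSlots, ⟪w, μ⟫_ℝ = 0 ∨ ⟪w, μ⟫_ℝ = Real.sqrt (2 / 3) ∨ ⟪w, μ⟫_ℝ = -Real.sqrt (2 / 3))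
    (hκc : List.IsChain (fun μ μ' => ⟪μ, μ'⟫_ℝ = 1 / 3 ∨ ⟪μ, μ'⟫_ℝ = -1 / 3) [κ₀, κ₁, κ₂])
    (hκ₂ : cubicCoords κ₂ = (Real.sqrt 3)⁻¹ • (![(1 : ℝ), 1, 1] : Fin 3 → ℝ) ∨
      cubicCoords κ₂ = -((Real.sqrt 3)⁻¹ • (![(1 : ℝ), 1, 1] : Fin 3 → ℝ)))
    (hκ₀₁ : ¬ ((cubicCoords κ₁ = (Real.sqrt 3)⁻¹ • (![(1 : ℝ), -1, -1] : Fin 3 → ℝ) ∨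
        cubicCoords κ₁ = -((Real.sqrt 3)⁻¹ • (![(1 : ℝ), -1, -1] : Fin 3 → ℝ))) ∧
      (cubicCoords κ₀ = (Real.sqrt 3)⁻¹ • (![(-1 : ℝ), -1, 1] : Fin 3 → ℝ) ∨
        cubicCoords κ₀ = -((Real.sqrt 3)⁻¹ • (![(-1 : ℝ), -1, 1] : Fin 3 → ℝ)))))
    (hB : B '' fccStacking 1 (Real.sqrt (2 / 3)) = (wordFrame A [κ₀, κ₁, κ₂]) '' fccStacking 1 (Real.sqrt (2 / 3))) :
    ∀ stk : List WalkEntry, StackSound z stk → StackWF z stk → stk.getLast? = some ⟨A, slotSite 8, 0⟩ →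
      ∀ e ∈ stk, e.frame '' fccStacking 1 (Real.sqrt (2 / 3)) ≠ B '' fccStacking 1 (Real.sqrt (2 / 3)) := by
  intro stk hS hW hlast e he hEq
  obtain ⟨hs2, hs3, hs2p, hs3p, h23⟩ := sqrt_two_three_facts
  obtain ⟨r, hS', hW', hl'⟩ := exists_suffix_of_mem stk e he hS hW
  rw [hlast] at hl'
  obtain ⟨hαl, hαc⟩ := stackWord_letters _ hS' hW'
  have hF : e.frame = wordFrame A (stackWord (e :: r)) := by
    rw [frame_eq_wordFrame e r hS', stackBase_eq_of_getLast? hl']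
  have himg := image_fccSlots_eq_of_image_fcc_eq _ _ (hEq.trans hB)
  rw [hF] at himg
  have hmap := map_reflection_eq_of_image_eq A hαl hαc hκl hκc himg
  -- the stack has exactly three pushes
  have hlen : r.length = 3 := by
    have h := congrArg List.length hmap
    rw [List.length_map, List.length_map, length_stackWord] at h
    simpa using h
  obtain ⟨e', e'', b, rfl⟩ := List.length_eq_three.1 hlen
  have hb : b = ⟨A, slotSite 8, 0⟩ := by
    rw [List.getLast?_cons_cons, List.getLast?_cons_cons, List.getLast?_cons_cons, List.getLast?_singleton,
      Option.some.injEq] at hl'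
    exact hl'
  have hbf : b.frame = A := by rw [hb]
  have hbd : b.dir = slotSite 8 := by rw [hb]
  obtain ⟨hSo, hLi, hSo', hLi', hSo'', hLi'', -⟩ := hS'
  obtain ⟨hdir, hne, hdir', hne', hdir'', -, -⟩ := hW'
  simp only [stackWord_cons_cons, stackWord_singleton, List.map_cons, List.map_nil, List.cons.injEq, and_true] at hmap
  obtain ⟨h0, h1, h2⟩ := hmap
  rw [hbf] at h2
  -- the first push normal `n = e''.nrm`
  have hn : ‖e''.nrm‖ = 1 := hSo''.2.1
  have hmenu'' := hSo''.2.2.1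
  have hfr'' : e''.frame = twinFrame A e''.nrm := by rw [← hbf]; exact frame_eq_twinFrame_of_link hn hLi''
  have hback : ∀ x, b.frame x = e''.frame x - (2 * ⟪e''.frame x, e''.nrm⟫_ℝ) • e''.nrm :=
    twin_symm b.frame e''.frame hn hLi''.1
  have hmenuA : ∀ w ∈ fccSlots, ⟪A w, e''.nrm⟫_ℝ = 0 ∨ ⟪A w, e''.nrm⟫_ℝ = Real.sqrt (2 / 3) ∨
      ⟪A w, e''.nrm⟫_ℝ = -Real.sqrt (2 / 3) := by
    rw [← hbf]; exact menu_reflect e''.frame b.frame hn hmenu'' hback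
  have hpos : ⟪A (slotSite 8), e''.nrm⟫_ℝ = Real.sqrt (2 / 3) := by rw [← hbf, ← hbd]; exact hLi''.2
  have hκ₂u : ‖κ₂‖ = 1 := (hκl κ₂ (by simp)).1
  have hκ₁u : ‖κ₁‖ = 1 := (hκl κ₁ (by simp)).1
  have hκ₀u : ‖κ₀‖ = 1 := (hκl κ₀ (by simp)).1
  have hlet0u : ‖A.symm e''.nrm‖ = 1 := by rw [LinearIsometryEquiv.norm_map, hn]
  -- letter 0 is `±κ₂`
  have e1 : A.symm e''.nrm = κ₂ ∨ A.symm e''.nrm = -κ₂ := eq_or_eq_neg_of_reflection_eq hlet0u hκ₂u h2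
  rcases first_normal_cubic A hn hmenuA hpos with hPa | hPb
  · -- ray a: levels 0 and 1 are forced, letters `(1,−1,−1)/√3` then `(−1,−1,1)/√3`
    have hpush'' : e'' = forcedTop z b e''.nrm 0 := by
      rw [forcedTop_zero]; exact head_eq_pushEntry hSo'' hLi'' hdir''
    rw [hb] at hpush''
    have hnrm' : e'.nrm = nextNormal e'' := nrm_eq_nextNormal hSo' hLi' hSo'' hne'
    have hpush' : e' = forcedTop z ⟨A, slotSite 8, 0⟩ e''.nrm 1 := by
      rw [forcedTop_succ, ← hpush'', ← hnrm']; exact head_eq_pushEntry hSo' hLi' hdir'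
    -- letter 1
    have hlet1 : cubicCoords (e''.frame.symm e'.nrm) = (Real.sqrt 3)⁻¹ • (![(1 : ℝ), -1, -1] : Fin 3 → ℝ) := by
      rw [hfr'', hnrm', hpush'']
      exact terrace_letter_one A hn hmenuA hpos hPa hZ ht
    have hlet1u : ‖e''.frame.symm e'.nrm‖ = 1 := by rw [LinearIsometryEquiv.norm_map]; exact hSo'.2.1
    have hκ₁eq : cubicCoords κ₁ = (Real.sqrt 3)⁻¹ • (![(1 : ℝ), -1, -1] : Fin 3 → ℝ) ∨
        cubicCoords κ₁ = -((Real.sqrt 3)⁻¹ • (![(1 : ℝ), -1, -1] : Fin 3 → ℝ)) := by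
      rcases eq_or_eq_neg_of_reflection_eq hlet1u hκ₁u h1 with h | h
      · exact Or.inl (by rw [← h, hlet1])
      · right
        have h' : κ₁ = -(e''.frame.symm e'.nrm) := by rw [h, neg_neg]
        rw [h', cubicCoords_neg, hlet1]
    -- letter 2
    have hnrm : e.nrm = nextNormal e' := nrm_eq_nextNormal hSo hLi hSo' hne
    have hlet2 : cubicCoords (e'.frame.symm e.nrm) = (Real.sqrt 3)⁻¹ • (![(-1 : ℝ), -1, 1] : Fin 3 → ℝ) := by
      rw [hnrm, hpush']
      exact terrace_letter_two A hn hmenuA hpos hPa hZ ht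
    have hlet2u : ‖e'.frame.symm e.nrm‖ = 1 := by rw [LinearIsometryEquiv.norm_map]; exact hSo.2.1
    have hκ₀eq : cubicCoords κ₀ = (Real.sqrt 3)⁻¹ • (![(-1 : ℝ), -1, 1] : Fin 3 → ℝ) ∨
        cubicCoords κ₀ = -((Real.sqrt 3)⁻¹ • (![(-1 : ℝ), -1, 1] : Fin 3 → ℝ)) := by
      rcases eq_or_eq_neg_of_reflection_eq hlet2u hκ₀u h0 with h | h
      · exact Or.inl (by rw [← h, hlet2])
      · right
        have h' : κ₀ = -(e'.frame.symm e.nrm) := by rw [h, neg_neg]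
        rw [h', cubicCoords_neg, hlet2]
    exact hκ₀₁ ⟨hκ₁eq, hκ₀eq⟩
  · -- ray b: the first letter is `(−1,1,1)/√3 ≠ ±κ₂` (its first two cubic coordinates differ)
    have hneq : cubicCoords (A.symm e''.nrm) 0 ≠ cubicCoords (A.symm e''.nrm) 1 := by
      rw [hPb]
      simp only [Pi.smul_apply, smul_eq_mul, Matrix.cons_val_zero, Matrix.cons_val_one]
      intro h
      have h3 : (Real.sqrt 3)⁻¹ = 0 := by linarith
      exact (inv_pos.2 hs3p).ne' h3
    have heq : cubicCoords (A.symm e''.nrm) 0 = cubicCoords (A.symm e''.nrm) 1 := by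
      rcases e1 with h | h <;> rcases hκ₂ with hk | hk
      · rw [h, hk]; simp
      · rw [h, hk]; simp
      · rw [h, cubicCoords_neg, hk]; simp
      · rw [h, cubicCoords_neg, hk]; simp
    exact hneq heq

end Summit.Ventures.Crystal3D.Theorems

end
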